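import Literature.Combinatorics.Sahi2008.UniformSquareAllOrders
import Summits.CriticalPhenomena.PercolationContinuityZ3.Theorems.PercNearOneGluingNoHeavyLowerTailSahiCombJunta
import Summits.CriticalPhenomena.PercolationContinuityZ3.Theorems.PercNearOneGluingNoHeavyLowerTailSahiCombCubeFiveAllOrders

/-!
# The free-slot junta theorem AT EVERY ORDER — one arbitrary increasing event and any number of events reading few common
# coordinates: Sahi's `C_n` (comb level) in every dimension

Support file (cell `prim-sahi`, seat `prim-sahi-typer` gen 36; `--supports stmt-CriticalPhenomena-4575`; proposed `--computational` because
the five-letter instance at the end inherits the declared `native_decide` axioms of `SahiCombFive.combPos_sahiE_of_card_le_five_all`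
(`…SahiCombCubeFiveAllOrders`); Parts 1–4 are pure, standard axioms).  No definitions, no named facts, no `sorry`.

P3's junta-intersection theorem (`…SahiCombJunta`, order `3`) runs DOMINATION → PEELING OF THE FREE SLOT → SUB-CUBE TRANSPORT.  The last two
steps use nothing about order `3`: `E_n` is linear in each slot and depends on a slot only through its mixed moments with products of the
other slots (`Literature.….sahiE_update_congr_of_moments`), so if every other slot ignores a coordinate `e`, conditioning the free slot on
`e` splits `E_n` as `p_e·E_n(U^{e←1},…) + (1−p_e)·E_n(U^{e←0},…)` at EVERY order.  This file records the all-orders forms: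

* Part 1 (`prod_ind_eq_ind_biInter` (with `ind_univ_eq_one` of `SahiMasterFamily`), `determinedBy_biInter`, `sahiE_ind_update_weight_of_determinedBy`): products of indicators of a family are
  indicators of intersections; `E_n(μ_p; 1_X)` does not depend on `p_e` when every `X_i` ignores `e` (`sahiE_congr_of_moments`).
* Part 2 (**`sahiE_update_peel`**): FIRST-SLOT PEELING AT ORDER `n` — if the slots `i ≠ k` ignore `e` then
  `E_n(μ_p; …, 1_U, …) = p_e·E_n(μ_p; …, 1_{U^{e←1}}, …) + (1 − p_e)·E_n(μ_p; …, 1_{U^{e←0}}, …)` (slot `k`).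
* Part 3 (**`combPos_sahiE_update_of_determinedBy_offSlot`**): if (M⁺-n) holds for all `n`-families of increasing `W`-determined events, it
  holds for every family whose slots other than `k` are increasing and `W`-determined and whose slot `k` is ANY increasing event
  (induction on the coordinates read by slot `k`, as in P3's `combPos_sahiE_three_of_determinedBy_pair`).
* Part 4 (**`combPos_sahiE_of_determinedBy_all_order`**): SUB-CUBE TRANSPORT AT ORDER `n` — (M⁺-n) on the cube `↥W` gives (M⁺-n) for every
  `n`-family of increasing `W`-determined events of `2^ι` (P3's `CombPos.comp_restr`, `sahiE_comp_restr`).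
* Part 5 — FIVE LETTERS, EVERY ORDER, EVERY DIMENSION (`SahiCombFive.combPos_sahiE_of_card_le_five_all`, typer gen 33/34):
  **`combPos_sahiE_of_allButOne_determinedBy_card_le_five`** — for every `n`, every finite `ι`, every `W ⊆ ι` with `|W| ≤ 5` and every
  family `X_0,…,X_{n−1}` of increasing events all but (at most) one of which are determined by `W`, the polynomial `p ↦ E_n(μ_p; 1_{X_0},…)`
  is a nonnegative combination of the degree-`n` tensor-Bernstein basis on `[0,1]^ι`; law level `sahiE_ind_nonneg_of_allButOne_…`
  (Sahi's `C_n` [Sahi2008, Conj. 5; LiebSahi2022, Conj. 1.1] for every product measure on this class: ONE ARBITRARY increasing event together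
  with any number of increasing events reading five common coordinates), and the pure-junta case `combPos_sahiE_of_determinedBy_all_card_le_five`.
At order `3` this is weaker than the junta-intersection theorem (which needs only `A ∩ B` to be a junta); at orders `n ≥ 4` it is new.
HONEST LABEL: Parts 1–4 pure; Part 5 computational (closure as stated); Sahi's `C_n` in general remains OPEN. [this work]
-/

noncomputable section

open scoped Classical

namespace Summit.CriticalPhenomena.PercolationContinuityZ3.Theorems

namespace SahiCombJunta

open Finset Function
open Literature.Combinatorics.Sahi2008
open Literature.Probability.Percolation (DeterminedBy determinedBy_iff)
open Literature.Probability.Percolation.DecisionTree (ind ind_of_mem ind_of_not_mem ind_nonneg)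
open SahiComb

variable {ι : Type} [Fintype ι]

/-! ### Part 1.  Products of indicators of a family; `p_e`-independence -/

omit [Fintype ι] in
/-- A product of indicators of a family over a finset of slots is the indicator of the intersection. [folklore] -/
theorem prod_ind_eq_ind_biInter {m : ℕ} (X : Fin m → Set (Set ι)) (S : Finset (Fin m)) :
    (∏ i ∈ S, ind (X i)) = ind (⋂ i ∈ S, X i) := by
  induction S using Finset.induction_on with
  | empty => simp only [Finset.prod_empty, Finset.notMem_empty, Set.iInter_of_empty, Set.iInter_univ, ind_univ_eq_one]
  | insert a S haS ih =>
    rw [Finset.prod_insert haS, ih, ind_mul_ind_eq_inter, Finset.set_biInter_insert]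

omit [Fintype ι] in
/-- An intersection of `F`-determined events is `F`-determined. [folklore] -/
theorem determinedBy_biInter {m : ℕ} {X : Fin m → Set (Set ι)} {F : Set ι} (S : Finset (Fin m))
    (hX : ∀ i ∈ S, DeterminedBy (X i) F) : DeterminedBy (⋂ i ∈ S, X i) F := by
  rw [determinedBy_iff]
  intro ω ω' h
  simp only [Set.mem_iInter]
  exact forall₂_congr fun i hi => (determinedBy_iff _ _).1 (hX i hi) ω ω' h

/-- **`E_n(μ_p; 1_X)` ignores `p_e` when every `X_i` ignores `e`.** [this work] -/
theorem sahiE_ind_update_weight_of_determinedBy (p : ι → unitInterval) (e : ι) (s : unitInterval) {m : ℕ}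
    (X : Fin m → Set (Set ι)) {F : Set ι} (hX : ∀ i, DeterminedBy (X i) F) (he : e ∉ F) :
    sahiE (bernoulliWeight (update p e s)) m (fun i => ind (X i)) = sahiE (bernoulliWeight p) m (fun i => ind (X i)) :=
  sahiE_congr_of_moments _ _ m _ _ fun S _ => by
    rw [prod_ind_eq_ind_biInter]
    exact ex_ind_update_of_determinedBy p e s (determinedBy_biInter S fun i _ => hX i) he

/-! ### Part 2.  First-slot peeling at every order -/

/-- **FIRST-SLOT PEELING AT ORDER `n`.**  If the slots `i ≠ k` of the family `X` ignore the coordinate `e` (they are determined by a set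
`F ∌ e`), then for every event `U` in slot `k`:
`E_n(μ_p; …,1_U,…) = p_e·E_n(μ_p; …,1_{U^{e←1}},…) + (1 − p_e)·E_n(μ_p; …,1_{U^{e←0}},…)`. [this work] -/
theorem sahiE_update_peel (p : ι → unitInterval) (e : ι) {m : ℕ} (X : Fin m → Set (Set ι)) (k : Fin m) (U : Set (Set ι))
    {F : Set ι} (hX : ∀ i, i ≠ k → DeterminedBy (X i) F) (he : e ∉ F) :
    sahiE (bernoulliWeight p) m (update (fun i => ind (X i)) k (ind U)) =
      (p e : ℝ) * sahiE (bernoulliWeight p) m (update (fun i => ind (X i)) k (ind (secAt e true U)))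
        + (1 - (p e : ℝ)) * sahiE (bernoulliWeight p) m (update (fun i => ind (X i)) k (ind (secAt e false U))) := by
  rw [← sahiE_update_lin]
  refine sahiE_update_congr_of_moments _ _ k fun S hkS => ?_
  have hG : DeterminedBy (⋂ i ∈ S, X i) F := determinedBy_biInter S fun i hi => hX i fun h => hkS (h ▸ hi)
  have hsec : ∀ b, secAt e b (⋂ i ∈ S, X i) = ⋂ i ∈ S, X i := fun b => secAt_eq_self_of_determinedBy hG he b
  rw [prod_ind_eq_ind_biInter X S, ind_mul_ind_eq_inter, ex_ind_eq_secAt p e, secAt_inter, secAt_inter, hsec, hsec,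
    add_mul, smul_mul_assoc, smul_mul_assoc, ind_mul_ind_eq_inter, ind_mul_ind_eq_inter, ex_add, ex_smul, ex_smul]

/-! ### Part 3.  Peeling the free slot, every order -/

/-- **The free slot, every order.**  If (M⁺-n) holds for all `n`-families of increasing `W`-determined events, then it holds for every
`n`-family whose slots other than `k` are increasing and `W`-determined and whose slot `k` is an arbitrary increasing event `U`.  Induction on
a finset `T` with `U` determined by `W ∪ T`, conditioning on one coordinate of `T ∖ W` at a time (`sahiE_update_peel`); the two sections are
increasing, read one coordinate fewer, and the pieces ignore `p_e` (`sahiE_ind_update_weight_of_determinedBy`). [this work] -/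
theorem combPos_sahiE_update_of_determinedBy_offSlot (W : Finset ι) {m : ℕ}
    (hbase : ∀ X : Fin m → Set (Set ι), (∀ i, IsUpperSet (X i)) → (∀ i, DeterminedBy (X i) (↑W : Set ι)) →
      CombPos (fun _ : ι => m) (fun p => sahiE (bernoulliWeight p) m (fun i => ind (X i))))
    (k : Fin m) {A : Fin m → Set (Set ι)} (hA : ∀ i, IsUpperSet (A i)) (hAd : ∀ i, i ≠ k → DeterminedBy (A i) (↑W : Set ι)) :
    ∀ (T : Finset ι) (U : Set (Set ι)), IsUpperSet U → DeterminedBy U (↑(W ∪ T) : Set ι) →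
      CombPos (fun _ : ι => m) (fun p => sahiE (bernoulliWeight p) m (fun i => ind (update A k U i))) := by
  intro T
  induction T using Finset.induction_on with
  | empty =>
    intro U hU hUd
    rw [Finset.union_empty] at hUd
    refine hbase (update A k U) (fun i => ?_) (fun i => ?_)
    · by_cases hi : i = k
      · subst hi; simpa using hU
      · rw [update_of_ne hi]; exact hA i
    · by_cases hi : i = k
      · subst hi; simpa using hUd
      · rw [update_of_ne hi]; exact hAd i hi
  | insert e T heT ih =>
    intro U hU hUd
    by_cases heW : e ∈ W
    · refine ih U hU ?_
      have : W ∪ insert e T = W ∪ T := by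
        ext x; simp only [Finset.mem_union, Finset.mem_insert]
        constructor
        · rintro (hx | rfl | hx)
          · exact Or.inl hx
          · exact Or.inl heW
          · exact Or.inr hx
        · rintro (hx | hx)
          · exact Or.inl hx
          · exact Or.inr (Or.inr hx)
      rwa [this] at hUd
    · -- condition on the coordinate `e ∉ W`
      have heWT : e ∉ W ∪ T := by simp [heW, heT]
      have hsec : ∀ b : Bool, IsUpperSet (secAt e b U) ∧ DeterminedBy (secAt e b U) (↑(W ∪ T) : Set ι) := fun b => by
        refine ⟨isUpperSet_secAt e b hU, ?_⟩
        have h := determinedBy_secAt e b hUd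
        have hE : (W ∪ insert e T).erase e = W ∪ T := by
          rw [Finset.union_insert, Finset.erase_insert heWT]
        rwa [hE] at h
      -- every slot of the section families is determined by `W ∪ T ∌ e`
      have hall : ∀ (b : Bool) (i : Fin m), DeterminedBy (update A k (secAt e b U) i) (↑(W ∪ T) : Set ι) := fun b i => by
        by_cases hi : i = k
        · subst hi; simpa using (hsec b).2
        · rw [update_of_ne hi]
          exact (hAd i hi).mono (by simp)
      have hrec : ∀ b : Bool, CombPos (update (fun _ : ι => m) e 0)
          (fun p => sahiE (bernoulliWeight p) m (fun i => ind (update A k (secAt e b U) i))) := fun b =>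
        (ih (secAt e b U) (hsec b).1 (hsec b).2).of_ignores e fun p s =>
          sahiE_ind_update_weight_of_determinedBy p e s _ (hall b) (by simpa using heWT)
      have hpe : CombPos (Pi.single e 1) (fun p : ι → unitInterval => (p e : ℝ)) := combPos_coord e
      have hqe : CombPos (Pi.single e 1) (fun p : ι → unitInterval => 1 - (p e : ℝ)) := combPos_one_sub_coord e
      have hm : 1 ≤ m := Fin.pos k
      have hdeg : Pi.single e 1 + update (fun _ : ι => m) e 0 ≤ fun _ : ι => m := by
        intro x
        by_cases hx : x = e
        · subst hx; simpa using hm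
        · simp [hx]
      -- the three families as updates of the indicator family
      have hupd : ∀ V : Set (Set ι), (fun i => ind (update A k V i)) = update (fun i => ind (A i)) k (ind V) := fun V => by
        funext i
        by_cases hi : i = k
        · subst hi; simp
        · rw [update_of_ne hi, update_of_ne hi]
      refine ((hpe.mul_of_le (hrec true) hdeg).add (hqe.mul_of_le (hrec false) hdeg)).congr fun p => ?_
      simp only [hupd]
      exact sahiE_update_peel p e A k U (F := (↑W : Set ι)) hAd (by simpa using heW)

/-! ### Part 4.  Sub-cube transport at every order -/

/-- **(M⁺-n) on the cube `↥W` ⟹ (M⁺-n) for every `n`-family of increasing `W`-determined events**, in every dimension (pull-back along the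
restriction `Set ι → Set ↥W`; P3's `CombPos.comp_restr` and `sahiE_comp_restr`). [this work] -/
theorem combPos_sahiE_of_determinedBy_all_order (W : Set ι) {m : ℕ}
    (hcube : ∀ Y : Fin m → Set (Set ↥W), (∀ i, IsUpperSet (Y i)) →
      CombPos (fun _ : ↥W => m) (fun q => sahiE (bernoulliWeight q) m (fun i => ind (Y i))))
    {X : Fin m → Set (Set ι)} (hX : ∀ i, IsUpperSet (X i)) (hXd : ∀ i, DeterminedBy (X i) W) :
    CombPos (fun _ : ι => m) (fun p => sahiE (bernoulliWeight p) m (fun i => ind (X i))) := by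
  have h := CombPos.comp_restr W (hcube (fun i => traceFam W (X i)) fun i => isUpperSet_traceFam W (hX i))
  refine (h.mono fun e => ?_).congr fun p => ?_
  · by_cases he : e ∈ W <;> simp [he]
  · rw [← sahiE_comp_restr W p m]
    congr 1
    funext i
    exact ind_eq_comp_restr_of_determinedBy W (hXd i)

/-- **All but one slot `W`-determined, from the cube `↥W`, every order.**  If (M⁺-n) holds on the cube `↥W` for all `n`-families, then it
holds, in every dimension, for every `n`-family of increasing events all of whose slots except possibly slot `k` are `W`-determined.
[this work] -/
theorem combPos_sahiE_of_allButOne_determinedBy (W : Set ι) {m : ℕ}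
    (hcube : ∀ Y : Fin m → Set (Set ↥W), (∀ i, IsUpperSet (Y i)) →
      CombPos (fun _ : ↥W => m) (fun q => sahiE (bernoulliWeight q) m (fun i => ind (Y i))))
    (k : Fin m) {X : Fin m → Set (Set ι)} (hX : ∀ i, IsUpperSet (X i)) (hXd : ∀ i, i ≠ k → DeterminedBy (X i) W) :
    CombPos (fun _ : ι => m) (fun p => sahiE (bernoulliWeight p) m (fun i => ind (X i))) := by
  have hbase : ∀ Y : Fin m → Set (Set ι), (∀ i, IsUpperSet (Y i)) → (∀ i, DeterminedBy (Y i) (↑W.toFinset : Set ι)) →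
      CombPos (fun _ : ι => m) (fun p => sahiE (bernoulliWeight p) m (fun i => ind (Y i))) :=
    fun Y hY hYd => combPos_sahiE_of_determinedBy_all_order W hcube hY fun i => by simpa using hYd i
  have hXd' : ∀ i, i ≠ k → DeterminedBy (X i) (↑W.toFinset : Set ι) := fun i hi => by simpa using hXd i hi
  have hUd : DeterminedBy (X k) (↑(W.toFinset ∪ Finset.univ) : Set ι) := by
    rw [determinedBy_iff]
    intro ω ω' h
    have : ω = ω' := by simpa using h
    rw [this]
  have key := combPos_sahiE_update_of_determinedBy_offSlot W.toFinset hbase k hX hXd' Finset.univ (X k) (hX k) hUd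
  rwa [update_eq_self] at key

/-! ### Part 5.  Five letters: every order, every dimension -/

/-- (M⁺-n) on every cube `↥W` with `|W| ≤ 5`, every `n` (typer gen 33/34's five-letter all-orders certificate). [this work] [computational] -/
theorem cubeCombPos_all_of_card_le_five (W : Set ι) (hW : Fintype.card ↥W ≤ 5) (m : ℕ) (Y : Fin m → Set (Set ↥W))
    (hY : ∀ i, IsUpperSet (Y i)) : CombPos (fun _ : ↥W => m) (fun q => sahiE (bernoulliWeight q) m (fun i => ind (Y i))) :=
  SahiCombFive.combPos_sahiE_of_card_le_five_all hW m Y hY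

/-- **THE FREE-SLOT JUNTA THEOREM, EVERY ORDER, FIVE COORDINATES.**  For every `n`, every finite `ι`, every `W ⊆ ι` with `|W| ≤ 5` and every
family `X_0,…,X_{n−1}` of increasing events of `2^ι` all of which, except possibly `X_k`, are determined by `W`: the polynomial
`p ↦ E_n(μ_p; 1_{X_0},…,1_{X_{n−1}})` is a nonnegative combination of the degree-`n` tensor-Bernstein basis on `[0,1]^ι` ((M⁺-n) on this
class). [this work] [computational] -/
theorem combPos_sahiE_of_allButOne_determinedBy_card_le_five (W : Finset ι) (hW : W.card ≤ 5) {m : ℕ} (k : Fin m)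
    {X : Fin m → Set (Set ι)} (hX : ∀ i, IsUpperSet (X i)) (hXd : ∀ i, i ≠ k → DeterminedBy (X i) (↑W : Set ι)) :
    CombPos (fun _ : ι => m) (fun p => sahiE (bernoulliWeight p) m (fun i => ind (X i))) :=
  combPos_sahiE_of_allButOne_determinedBy (↑W : Set ι) (cubeCombPos_all_of_card_le_five _ (by
    rw [← Set.toFinset_card, Finset.toFinset_coe]
    exact hW) m) k hX hXd

/-- Law level: **Sahi's `C_n` for every product measure, every order, every dimension, on the class "one arbitrary increasing event + any
number of increasing events reading at most five common coordinates"**: `E_n(μ_p; 1_{X_0},…,1_{X_{n−1}}) ≥ 0`. [this work] [computational] -/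
theorem sahiE_ind_nonneg_of_allButOne_determinedBy_card_le_five (p : ι → unitInterval) (W : Finset ι) (hW : W.card ≤ 5) {m : ℕ}
    (k : Fin m) {X : Fin m → Set (Set ι)} (hX : ∀ i, IsUpperSet (X i)) (hXd : ∀ i, i ≠ k → DeterminedBy (X i) (↑W : Set ι)) :
    0 ≤ sahiE (bernoulliWeight p) m (fun i => ind (X i)) :=
  (combPos_sahiE_of_allButOne_determinedBy_card_le_five W hW k hX hXd).nonneg p

/-- Density-free zero set on the class: a zero of `p ↦ E_n(μ_p; 1_X)` at one interior point forces zero on all of `[0,1]^ι`.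
[this work] [computational] -/
theorem sahiE_ind_eq_zero_of_interior_zero_of_allButOne_determinedBy_card_le_five (W : Finset ι) (hW : W.card ≤ 5) {m : ℕ}
    (k : Fin m) {X : Fin m → Set (Set ι)} (hX : ∀ i, IsUpperSet (X i)) (hXd : ∀ i, i ≠ k → DeterminedBy (X i) (↑W : Set ι))
    {q : ι → unitInterval} (hq : ∀ e, (q e : ℝ) ∈ Set.Ioo (0 : ℝ) 1) (h0 : sahiE (bernoulliWeight q) m (fun i => ind (X i)) = 0)
    (p : ι → unitInterval) : sahiE (bernoulliWeight p) m (fun i => ind (X i)) = 0 :=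
  (combPos_sahiE_of_allButOne_determinedBy_card_le_five W hW k hX hXd).eq_zero_of_interior hq h0 p

/-- The pure-junta case, every order: all `n` events increasing and determined by a common `W` with `|W| ≤ 5` ⟹ (M⁺-n), every dimension.
[this work] [computational] -/
theorem combPos_sahiE_of_determinedBy_all_card_le_five (W : Finset ι) (hW : W.card ≤ 5) {m : ℕ} {X : Fin m → Set (Set ι)}
    (hX : ∀ i, IsUpperSet (X i)) (hXd : ∀ i, DeterminedBy (X i) (↑W : Set ι)) :
    CombPos (fun _ : ι => m) (fun p => sahiE (bernoulliWeight p) m (fun i => ind (X i))) :=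
  combPos_sahiE_of_determinedBy_all_order (↑W : Set ι) (cubeCombPos_all_of_card_le_five _ (by
    rw [← Set.toFinset_card, Finset.toFinset_coe]
    exact hW) m) hX hXd

end SahiCombJunta

end Summit.CriticalPhenomena.PercolationContinuityZ3.Theorems
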